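import Literature.NumberTheory.EllipticCurves.TianYuanZhang2017.CMPointClassFieldBeta
import HarnessLib

/-!
# Route B's displayed hypothesis REDUCED A FOURTH TIME: the inclusion «`A[2] ⊆ (β+1)A[4]`» of the `β′`-facts (`n` even)
# is a kernel theorem of «`β` acts on `ℚ(i)` trivially» and the `4`-torsion of `A` as well — so the WHOLE printed identity
# «`(β+1)A[4] = A[2]`» is a kernel theorem of the displayed field action of `β`; the named fact
# `tyz_cmPointClassFieldDataBetaField` ⟺ `tyz_cmPointClassFieldDataBeta` ⟺ … ⟺ `tyz_cmPointClassFieldData`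

A FOURTH derivability pass over route B's displayed hypothesis (cell `bsd-monsky`, typer seat g18; the earlier passes are
`CMPointClassFieldReduced.lean` (hCF′), `CMPointClassFieldTorsion.lean` (hCF″) and `CMPointClassFieldBeta.lean` (hCF‴)).
`GenusPointData.betaSpecCore` displays the Galois facts on `β′` used in the proof of [TianYuanZhang2017] Thm. 3.5 (2):
«`β` acts on `K_n` by `√−n ↦ −√−n`» (p0020 L118), «`β` acts on `ℚ(i)` trivially» (p0020 L121) and, for `n` even, the
inclusion «`A[2] ⊆ (β+1)A[4]`» («`∀ T, 2T = 0 → ∃ Q, 4Q = 0 ∧ βQ + Q = T`») — the half of the printed identity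
«`P(n)^β + P(n) ∈ (β+1)A[4] = A[2]` by Lemma 3.17» (p0020 L146) left displayed by the third pass.

## The struck conjunct and its derivation (a CENSUS CORRECTION)

The third pass recorded «the ⊇ half stays: `β` on `√2` is not displayed (countermodel `β(√2) = −√2`, `β·ptQ = ptQ + (2i, 0)`,
image `{O, (0,0)}`)».  That countermodel is IMPOSSIBLE: a `ℚ`-automorphism `β` of `ℍ′_n` with `β(i) = i` satisfies
`β(√2) = ±√2` (`β(√2)² = 2`), and on the explicit half `ptQ = (2i(1 + √2), (2√2 + 4)(1 − i))` of `(2i, 0)`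
(`CurveAFourTorsion.lean`) it acts COORDINATEWISE: `β(ptQ) = (2i(1 + β√2), (2β√2 + 4)(1 − i))` = `ptQ` if `β√2 = √2`, and
`= (2i(1 − √2), (4 − 2√2)(1 − i)) = ptQ + τ(1)` if `β√2 = −√2` (`ptQ_neg_eq_add_tauOne`: the chord through `ptQ` and
`τ(1) = (0, 0)` has slope `−√2(1 + i)`).  Hence `(β+1)·ptQ = 2·ptQ = (2i, 0)` or `= 2·ptQ + τ(1) = (−2i, 0)`, and
`(β+1)(ptQ + τ(1/2)) = (β+1)·ptQ + τ(1)` is the other one (`τ(1/2) = (2, 4)` is rational, `(0,0) + (±2i, 0) = (∓2i, 0)`);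
with `(β+1)τ(1/2) = τ(1)` and `(β+1)O = O` every point of `A[2] = {O, (0,0), (2i,0), (−2i,0)}` is of the form
`βQ + Q` with `4Q = 0` (`exists_four_nsmul_eq_zero_and_map_add_eq`, for ANY field `H` of characteristic `0` containing
`i` and `√2` and ANY `ℚ`-algebra endomorphism fixing `i`; on the data, `√2 = i·√−2 ∈ ℍ′_n` for `n` even,
`exists_four_nsmul_eq_zero_and_betaPt_add_eq`).  Together with the third pass (`two_nsmul_betaPt_add_of_four_nsmul_eq_zero`)
the WHOLE printed set identity «`(β+1)A[4] = A[2]`» is a kernel theorem of «`β(i) = i`» and the `4`-torsion of `A` — for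
both packages `β₁′` (`β|_{ℚ(ζ₈)} = id`) and `β₂′` (`β|_{ℚ(ζ₈)} = κ`, Lemma 3.17) uniformly, which is exactly why the
display never needed «`β = κ`» (rider R-a of `GenusPointDescentDisplays.lean`).

`betaSpecField` (= `betaSpecCore` with the inclusion struck: the two sentences on the FIELD action of `β`, VERBATIM),
`betaSpecCore_iff_field` / `betaSpec_iff_field` (for `n ≠ 0`), `PrintedBetaField` (= `PrintedBeta` with
`betaSpecCore ↦ betaSpecField`), and the named fact **hCF⁗ = `tyz_cmPointClassFieldDataBetaField`** with
`tyz_cmPointClassFieldDataBeta_iff_betaField` and `tyz_cmPointClassFieldData_iff_betaField` (hCF ⟺ hCF′ ⟺ hCF″ ⟺ hCF‴ ⟺ hCF⁗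
in the kernel).  HONEST ACCOUNTING: the struck conjunct is the second HALF of a printed identity (p0020 L146) — a content
removal; after it, `betaSpecField` displays no sentence on the action of `β` on points at all.  What remains of the
`β′`-facts — «`β(√−n) = −√−n`», «`β(i) = i`» — are the only displayed sentences on the field values of `β` and are not
derivable from the rest (the display fixes `β` nowhere else; information, not minimality).  HONEST FRAMING: hCF⁗ is a named
fact with NO `_holds`; consumers take it as a hypothesis; every consumer of `tyz_cmPointClassFieldData` runs unchanged
through `tyz_cmPointClassFieldData_of_betaField`.  Origin: cell `bsd-monsky` (run/shared/lean/pub/bsd-monsky/), typer seat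
g18; locators p00NN Lmm = arXiv chunk of `paper:arxiv-1411.4728`.

References: [TianYuanZhang2017] proof of Thm. 3.5 (2) (p0020 L107–L122, L143–L148), Lemma 3.16 (p0017 L98–L101),
Lemma 3.17 (p0017 L136–L149); [SilvermanAEC2009] III.2.3.
-/

noncomputable section

open scoped Classical

open WeierstrassCurve WeierstrassCurve.Affine

namespace Literature.NumberTheory.EllipticCurves.TianYuanZhang2017

/-! ## §1 The `2`-torsion addition table of `A`, and `β(ptQ)` for a field automorphism fixing `i` -/

section Curve

variable {H : Type} [Field H] [CharZero H]

/-- `i ≠ 0` for `i² = −1`. [cite: SilvermanAEC2009, III.2.3] -/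
theorem ne_zero_of_sq_eq_neg_one (im : H) (him : im ^ 2 = -1) : im ≠ 0 := by
  intro e; rw [e] at him; norm_num at him

/-- **`(0, 0) + (2i, 0) = (−2i, 0)`** (the chord is the `X`-axis). [cite: TianYuanZhang2017, Lemma 3.16 (p0017 L98–L101)]
[cite: SilvermanAEC2009, III.2.3] -/
theorem tauOne_add_ptTwoI (im : H) (him : im ^ 2 = -1) :
    (tauOne : APoint H) + ptTwoI im him = ptNegTwoI im him := by
  obtain ⟨h1, h2, -, -, -⟩ := curveA_baseChange_a (H := H)
  have hx : (0 : H) ≠ 2 * im := by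
    intro e
    exact ne_zero_of_sq_eq_neg_one im him (by linear_combination -e / 2)
  have hslope : (curveA.baseChange H).toAffine.slope 0 (2 * im) 0 0 = 0 := by
    rw [WeierstrassCurve.Affine.slope_of_X_ne hx]; simp
  rw [tauOne, ptTwoI, Point.add_of_X_ne hx, ptNegTwoI]
  simp only [Point.some.injEq]
  refine ⟨?_, ?_⟩
  · rw [WeierstrassCurve.Affine.addX, hslope, h1, h2]; ring
  · rw [WeierstrassCurve.Affine.addY, WeierstrassCurve.Affine.negAddY, WeierstrassCurve.Affine.addX,
      curveA_negY, hslope, h1, h2]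
    ring

/-- **`(0, 0) + (−2i, 0) = (2i, 0)`**. [cite: TianYuanZhang2017, Lemma 3.16 (p0017 L98–L101)] [cite: SilvermanAEC2009, III.2.3] -/
theorem tauOne_add_ptNegTwoI (im : H) (him : im ^ 2 = -1) :
    (tauOne : APoint H) + ptNegTwoI im him = ptTwoI im him := by
  obtain ⟨h1, h2, -, -, -⟩ := curveA_baseChange_a (H := H)
  have hx : (0 : H) ≠ -(2 * im) := by
    intro e
    exact ne_zero_of_sq_eq_neg_one im him (by linear_combination e / 2)
  have hslope : (curveA.baseChange H).toAffine.slope 0 (-(2 * im)) 0 0 = 0 := by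
    rw [WeierstrassCurve.Affine.slope_of_X_ne hx]; simp
  rw [tauOne, ptNegTwoI, Point.add_of_X_ne hx, ptTwoI]
  simp only [Point.some.injEq]
  refine ⟨?_, ?_⟩
  · rw [WeierstrassCurve.Affine.addX, hslope, h1, h2]; ring
  · rw [WeierstrassCurve.Affine.addY, WeierstrassCurve.Affine.negAddY, WeierstrassCurve.Affine.addX,
      curveA_negY, hslope, h1, h2]
    ring

/-- `ptQ` depends only on the value of the square root `s` of `2`. [cite: SilvermanAEC2009, III.2.3] -/
theorem ptQ_congr (im : H) (him : im ^ 2 = -1) {s₁ s₂ : H} (hs₁ : s₁ ^ 2 = 2) (hs₂ : s₂ ^ 2 = 2)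
    (h : s₁ = s₂) : ptQ im s₁ him hs₁ = ptQ im s₂ him hs₂ := by
  subst h; rfl

/-- **`ptQ` with `√2 ↦ −√2` is `ptQ + (0, 0)`**: `(2i(1 − √2), (4 − 2√2)(1 − i)) = ptQ + τ(1)`, the chord through
`ptQ = (2i(1 + √2), (2√2 + 4)(1 − i))` and `(0, 0)` having slope `ℓ = −√2(1 + i)` (`ℓ² − x = 2i(1 − √2)`,
`ℓ(x − ℓ² + x) − y = (4 − 2√2)(1 − i)`). [cite: TianYuanZhang2017, Lemma 3.16 (p0017 L98–L101), Lemma 3.17 (p0017 L136–L149)]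
[cite: SilvermanAEC2009, III.2.3] -/
theorem ptQ_neg_eq_add_tauOne (im s : H) (him : im ^ 2 = -1) (hs : s ^ 2 = 2) (hs' : (-s) ^ 2 = 2) :
    ptQ im (-s) him hs' = ptQ im s him hs + tauOne := by
  obtain ⟨hs1, -, -, hi0⟩ := aux_ne_zero im s him hs
  obtain ⟨h1, h2, -, -, -⟩ := curveA_baseChange_a (H := H)
  have hx : 2 * im * (1 + s) ≠ (0 : H) := mul_ne_zero (mul_ne_zero two_ne_zero hi0) hs1
  have hslope : (curveA.baseChange H).toAffine.slope (2 * im * (1 + s)) 0 ((2 * s + 4) * (1 - im)) 0 =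
      -s * (1 + im) := by
    rw [WeierstrassCurve.Affine.slope_of_X_ne hx, sub_zero, sub_zero, div_eq_iff hx]
    linear_combination (2 * s ^ 2 + 2 * s) * him + (2 * im + (-2 : H)) * hs
  rw [ptQ, ptQ, tauOne, Point.add_of_X_ne hx]
  simp only [Point.some.injEq]
  refine ⟨?_, ?_⟩
  · rw [WeierstrassCurve.Affine.addX, hslope, h1, h2]
    linear_combination (-(s ^ 2)) * him + (-(2 * im)) * hs
  · rw [WeierstrassCurve.Affine.addY, WeierstrassCurve.Affine.negAddY, WeierstrassCurve.Affine.addX,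
      curveA_negY, hslope, h1, h2]
    linear_combination (-(im * s ^ 3 + 3 * s ^ 3 + (-4 : H) * s ^ 2 + (-4 : H) * s)) * him +
      (-(2 * im * s + (-4 : H) * im + (-2 : H) * s + 4)) * hs

/-- **A `ℚ`-algebra endomorphism `f` of `H` fixing `i` acts on `ptQ` through its value on `√2`**:
`f(ptQ(√2)) = ptQ(f√2)` (the coordinates of `ptQ` are polynomials in `i` and `√2` with rational coefficients).
[cite: TianYuanZhang2017, Lemma 3.16 (p0017 L98–L101: ℚ(A[4]) = ℚ(√2, i))] -/
theorem map_ptQ (f : H →ₐ[ℚ] H) (im s : H) (him : im ^ 2 = -1) (hs : s ^ 2 = 2) (hfi : f im = im) :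
    Point.map (W' := curveA) f (ptQ im s him hs) =
      ptQ im (f s) him (by rw [← map_pow, hs, map_ofNat]) := by
  rw [ptQ, ptQ, Point.map_some, Point.some.injEq]
  refine ⟨?_, ?_⟩
  · simp only [map_mul, map_add, map_one, map_ofNat, hfi]
  · simp only [map_mul, map_add, map_sub, map_one, map_ofNat, hfi]

/-- **`f` fixes `τ(1/2) = (2, 4)`** (rational coordinates). [cite: TianYuanZhang2017, §3.2 (p0012 L8–L18)] -/
theorem map_tauHalf (f : H →ₐ[ℚ] H) : Point.map (W' := curveA) f (tauHalf : APoint H) = tauHalf := by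
  rw [tauHalf, Point.map_some, Point.some.injEq]
  exact ⟨map_ofNat _ _, map_ofNat _ _⟩

/-- **`(f+1)·ptQ ∈ {(2i, 0), (−2i, 0)}`** for a `ℚ`-algebra endomorphism `f` fixing `i`: `f√2 = ±√2`; if `f√2 = √2` then
`f(ptQ) = ptQ` and `(f+1)ptQ = 2·ptQ = (2i, 0)`; if `f√2 = −√2` then `f(ptQ) = ptQ + (0, 0)` and `(f+1)ptQ = (2i, 0) + (0, 0)
= (−2i, 0)`. [cite: TianYuanZhang2017, Lemma 3.17 (p0017 L136–L149), proof of Thm. 3.5 (2) (p0020 L146)]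
[cite: SilvermanAEC2009, III.2.3] -/
theorem map_ptQ_add_ptQ (f : H →ₐ[ℚ] H) (im s : H) (him : im ^ 2 = -1) (hs : s ^ 2 = 2) (hfi : f im = im) :
    Point.map (W' := curveA) f (ptQ im s him hs) + ptQ im s him hs = ptTwoI im him ∨
      Point.map (W' := curveA) f (ptQ im s him hs) + ptQ im s him hs = ptNegTwoI im him := by
  have hfs : f s = s ∨ f s = -s := by
    have h : (f s) ^ 2 = s ^ 2 := by rw [← map_pow, hs, map_ofNat]
    exact sq_eq_sq_iff_eq_or_eq_neg.mp h
  rw [map_ptQ f im s him hs hfi]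
  rcases hfs with h | h
  · left
    rw [ptQ_congr im him _ hs h, ← two_nsmul, two_nsmul_ptQ]
  · right
    rw [ptQ_congr im him _ (by rw [neg_sq]; exact hs) h, ptQ_neg_eq_add_tauOne im s him hs, add_right_comm,
      ← two_nsmul, two_nsmul_ptQ, add_comm, tauOne_add_ptTwoI]

/-- **Every `2`-torsion point of `A(H)` is `fQ + Q` for a `4`-torsion point `Q`**, for any field `H` of characteristic `0`
containing `i` and `√2` and any `ℚ`-algebra endomorphism `f` of `H` with `f(i) = i` — the inclusion «`A[2] ⊆ (f+1)A[4]`»: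
`O = (f+1)O`, `(0, 0) = (f+1)τ(1/2)`, and `(2i, 0)`, `(−2i, 0)` are `(f+1)·ptQ` and `(f+1)(ptQ + τ(1/2))` in one order or
the other (`map_ptQ_add_ptQ`). [cite: TianYuanZhang2017, Lemma 3.17 (p0017 L136–L149), proof of Thm. 3.5 (2) (p0020 L146)]
[cite: SilvermanAEC2009, III.2.3] -/
theorem exists_four_nsmul_eq_zero_and_map_add_eq (f : H →ₐ[ℚ] H) (im s : H) (him : im ^ 2 = -1)
    (hs : s ^ 2 = 2) (hfi : f im = im) {T : APoint H} (hT : (2 : ℕ) • T = 0) :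
    ∃ Q : APoint H, (4 : ℕ) • Q = 0 ∧ Point.map (W' := curveA) f Q + Q = T := by
  have hτ := map_tauHalf (H := H) f
  have h4 : ∀ Q : APoint H, (4 : ℕ) • Q = 0 → (4 : ℕ) • (Q + tauHalf) = 0 := by
    intro Q hQ
    rw [smul_add, hQ, four_nsmul_tauHalf, add_zero]
  have hsum : ∀ Q : APoint H, Point.map (W' := curveA) f (Q + tauHalf) + (Q + tauHalf) =
      (Point.map (W' := curveA) f Q + Q) + tauOne := by
    intro Q
    rw [map_add, hτ, ← two_nsmul_tauHalf, two_nsmul]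
    abel
  have hQ := map_ptQ_add_ptQ f im s him hs hfi
  rcases eq_of_two_nsmul_eq_zero im him hT with rfl | rfl | rfl | rfl
  · exact ⟨0, smul_zero _, by rw [map_zero, add_zero]⟩
  · exact ⟨tauHalf, four_nsmul_tauHalf, by rw [hτ, ← two_nsmul, two_nsmul_tauHalf]⟩
  · rcases hQ with h | h
    · exact ⟨ptQ im s him hs, four_nsmul_ptQ im s him hs, h⟩
    · exact ⟨ptQ im s him hs + tauHalf, h4 _ (four_nsmul_ptQ im s him hs),
        by rw [hsum, h, add_comm, tauOne_add_ptNegTwoI]⟩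
  · rcases hQ with h | h
    · exact ⟨ptQ im s him hs + tauHalf, h4 _ (four_nsmul_ptQ im s him hs),
        by rw [hsum, h, add_comm, tauOne_add_ptTwoI]⟩
    · exact ⟨ptQ im s him hs, four_nsmul_ptQ im s him hs, h⟩

end Curve

/-! ## §2 On the data `D`: for `n` even, «`A[2] ⊆ (β+1)A[4]`» from «`β(i) = i`» alone -/

namespace GenusPointData

variable {n : ℕ}

/-- **«`A[2] ⊆ (β+1)A[4]`» is a kernel theorem of «`β(i) = i`» and the data**: for `n` even, `√2 = i·√−2 ∈ ℍ′_n`, and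
`exists_four_nsmul_eq_zero_and_map_add_eq` applies to `β = β′|_{ℍ′_n}`.
[cite: TianYuanZhang2017, proof of Thm. 3.5 (2) (p0020 L121, L146), Lemma 3.17 (p0017 L136–L149), §3.1 (p0011 L60–L64)] -/
theorem exists_four_nsmul_eq_zero_and_betaPt_add_eq (D : GenusPointData n) (hn : n ≠ 0) (heven : Even n)
    (hβi : D.beta D.im = D.im) {T : APoint D.H} (hT : (2 : ℕ) • T = 0) :
    ∃ Q : APoint D.H, (4 : ℕ) • Q = 0 ∧ D.betaPt Q + Q = T := by
  have h2 : 2 ∈ n.divisors := Nat.mem_divisors.mpr ⟨even_iff_two_dvd.mp heven, hn⟩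
  have hs : (D.im * D.sqrtNeg 2) ^ 2 = 2 := by
    rw [mul_pow, D.im_sq, D.sqrtNeg_sq 2 h2]; push_cast; ring
  exact exists_four_nsmul_eq_zero_and_map_add_eq D.beta.toAlgHom D.im (D.im * D.sqrtNeg 2) D.im_sq hs hβi hT

/-! ## §3 The `β′`-facts with the second inclusion struck as well -/

/-- **`betaSpecCore` with «`A[2] ⊆ (β+1)A[4]`» struck**: «`β` acts on `K_n` by `√−n ↦ −√−n`» (p0020 L118) and «`β` acts on
`ℚ(i)` trivially» (p0020 L121) — the two displayed sentences on the FIELD action of `β`, VERBATIM; no sentence on the action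
of `β` on points remains. A predicate; nothing asserted.
[cite: TianYuanZhang2017, proof of Thm. 3.5 (2) (chunk p0020 L107–L122)] -/
def betaSpecField (D : GenusPointData n) : Prop :=
  (n ∈ n.divisors → D.beta (D.sqrtNeg n) = -D.sqrtNeg n) ∧ D.beta D.im = D.im

/-- `betaSpecCore ⟹ betaSpecField` (drop the inclusion). [cite: TianYuanZhang2017, proof of Thm. 3.5 (2) (p0020 L146)] -/
theorem betaSpecField_of_betaSpecCore (D : GenusPointData n) (h : D.betaSpecCore) : D.betaSpecField :=
  ⟨h.1, h.2.1⟩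

/-- **`betaSpecField ⟹ betaSpecCore`** for `n ≠ 0`: the struck inclusion from «`β(i) = i`» and the `4`-torsion of `A`.
[cite: TianYuanZhang2017, proof of Thm. 3.5 (2) (p0020 L121, L146), Lemma 3.17 (p0017 L136–L149)] -/
theorem betaSpecCore_of_field (D : GenusPointData n) (hn : n ≠ 0) (h : D.betaSpecField) : D.betaSpecCore :=
  ⟨h.1, h.2, fun heven _ hT => D.exists_four_nsmul_eq_zero_and_betaPt_add_eq hn heven h.2 hT⟩

/-- **`betaSpecCore ⟺ betaSpecField`** for `n ≠ 0`. [cite: TianYuanZhang2017, proof of Thm. 3.5 (2) (p0020 L107–L122, L143–L148)] -/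
theorem betaSpecCore_iff_field (D : GenusPointData n) (hn : n ≠ 0) : D.betaSpecCore ↔ D.betaSpecField :=
  ⟨D.betaSpecField_of_betaSpecCore, D.betaSpecCore_of_field hn⟩

/-- **`betaSpec ⟺ betaSpecField`** for `n ≠ 0`: the whole printed identity «`(β+1)A[4] = A[2]`» (`n` even) is a kernel
theorem of «`β(i) = i`». [cite: TianYuanZhang2017, proof of Thm. 3.5 (2) (p0020 L107–L122, L143–L148), Lemma 3.17 (p0017 L136–L149)] -/
theorem betaSpec_iff_field (D : GenusPointData n) (hn : n ≠ 0) : D.betaSpec ↔ D.betaSpecField :=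
  D.betaSpec_iff_core.trans (D.betaSpecCore_iff_field hn)

/-- **`PrintedBeta` with `betaSpecCore ↦ betaSpecField`** (the nine other conjuncts VERBATIM, in the same order). A predicate;
nothing asserted. [cite: TianYuanZhang2017, §3 (Prop. 3.4, Thm. 3.5, Lemma 3.18, Lemma 3.21, proof of Thm. 3.5 (2))] -/
def PrintedBetaField (D : GenusPointData n) : Prop :=
  D.scriptLSpec ∧ D.epsSpec ∧ D.recursion ∧ D.prop34 ∧ D.thm35Main ∧ D.thm35Bullet1 ∧
    D.thm35Bullet2Ie ∧ D.lemma318Core ∧ D.betaSpecField ∧ D.lemma321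

/-- `PrintedBeta ⟹ PrintedBetaField`. [cite: TianYuanZhang2017, §3] -/
theorem printedBetaField_of_printedBeta (D : GenusPointData n) (h : D.PrintedBeta) : D.PrintedBetaField := by
  obtain ⟨h1, h2, h3, h4, h5, h6, h7, h8, h9, h10⟩ := h
  exact ⟨h1, h2, h3, h4, h5, h6, h7, h8, D.betaSpecField_of_betaSpecCore h9, h10⟩

/-- `PrintedBetaField ⟹ PrintedBeta` for `n ≠ 0`. [cite: TianYuanZhang2017, proof of Thm. 3.5 (2) (p0020 L121, L146)] -/
theorem printedBeta_of_printedBetaField (D : GenusPointData n) (hn : n ≠ 0) (h : D.PrintedBetaField) :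
    D.PrintedBeta := by
  obtain ⟨h1, h2, h3, h4, h5, h6, h7, h8, h9, h10⟩ := h
  exact ⟨h1, h2, h3, h4, h5, h6, h7, h8, D.betaSpecCore_of_field hn h9, h10⟩

/-- **`PrintedBeta ⟺ PrintedBetaField`** for `n ≠ 0`. [cite: TianYuanZhang2017, §3] -/
theorem printedBeta_iff_printedBetaField (D : GenusPointData n) (hn : n ≠ 0) :
    D.PrintedBeta ↔ D.PrintedBetaField :=
  ⟨D.printedBetaField_of_printedBeta, D.printedBeta_of_printedBetaField hn⟩

end GenusPointData

/-! ## §4 The ONE named fact, and its equivalences -/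

/-- **Tian–Yuan–Zhang 2017, §3 with the CM-point layer and its class fields AS PRINTED, REDUCED FOUR TIMES, as ONE named
fact**: for every positive square-free `n ≡ 5, 6, 7 (mod 8)` there are data `D : GenusPointData n` satisfying
`PrintedBetaField` and `CMPointClassFieldPrintedTorsion`.  EQUIVALENT in the kernel to `tyz_cmPointClassFieldDataBeta`,
`tyz_cmPointClassFieldDataTorsion`, `tyz_cmPointClassFieldDataReduced` and `tyz_cmPointClassFieldData`; no `_holds`
expected; consumers take it as an explicit hypothesis; nothing is asserted here.
[cite: TianYuanZhang2017, §3: §3.1 (J738–J739), Prop. 3.2, Prop. 3.4, Thm. 3.5 and the proof of Thm. 3.5 (2) (p0020 L107–L122, L143–L148), Thm. 3.6 (J741), Lemma 3.16, Lemma 3.17, Lemma 3.18, Lemma 3.21 and its proof (J759), §2.1 (J725)]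
[cite: Cox2013, Theorem 6.1 (ii), Theorem 9.18, Lemma 9.3, (5.12)] -/
def tyz_cmPointClassFieldDataBetaField : Prop :=
  ∀ (n : ℕ), Squarefree n → (n % 8 = 5 ∨ n % 8 = 6 ∨ n % 8 = 7) →
    ∃ D : GenusPointData n, D.PrintedBetaField ∧ D.CMPointClassFieldPrintedTorsion

/-- `tyz_cmPointClassFieldDataBetaField ⟹ tyz_cmPointClassFieldDataBeta` (`n ≠ 0` from `Squarefree n`).
[cite: TianYuanZhang2017, proof of Thm. 3.5 (2) (p0020 L121, L146)] -/
theorem tyz_cmPointClassFieldDataBeta_of_betaField (h : tyz_cmPointClassFieldDataBetaField) :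
    tyz_cmPointClassFieldDataBeta := by
  intro n hn h8
  obtain ⟨D, hD, hC⟩ := h n hn h8
  exact ⟨D, D.printedBeta_of_printedBetaField hn.ne_zero hD, hC⟩

/-- `tyz_cmPointClassFieldDataBeta ⟹ tyz_cmPointClassFieldDataBetaField`. [cite: TianYuanZhang2017, §3] -/
theorem tyz_cmPointClassFieldDataBetaField_of_beta (h : tyz_cmPointClassFieldDataBeta) :
    tyz_cmPointClassFieldDataBetaField := by
  intro n hn h8
  obtain ⟨D, hD, hC⟩ := h n hn h8
  exact ⟨D, D.printedBetaField_of_printedBeta hD, hC⟩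

/-- **`tyz_cmPointClassFieldDataBeta ⟺ tyz_cmPointClassFieldDataBetaField`** in the kernel. [cite: TianYuanZhang2017, §3] -/
theorem tyz_cmPointClassFieldDataBeta_iff_betaField :
    tyz_cmPointClassFieldDataBeta ↔ tyz_cmPointClassFieldDataBetaField :=
  ⟨tyz_cmPointClassFieldDataBetaField_of_beta, tyz_cmPointClassFieldDataBeta_of_betaField⟩

/-- `tyz_cmPointClassFieldDataBetaField ⟹ tyz_cmPointClassFieldData` (the direction the doors use). [cite: TianYuanZhang2017, §3] -/
theorem tyz_cmPointClassFieldData_of_betaField (h : tyz_cmPointClassFieldDataBetaField) :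
    tyz_cmPointClassFieldData :=
  tyz_cmPointClassFieldData_of_beta (tyz_cmPointClassFieldDataBeta_of_betaField h)

/-- **`tyz_cmPointClassFieldData ⟺ tyz_cmPointClassFieldDataBetaField`** in the kernel. [cite: TianYuanZhang2017, §3] -/
theorem tyz_cmPointClassFieldData_iff_betaField :
    tyz_cmPointClassFieldData ↔ tyz_cmPointClassFieldDataBetaField :=
  tyz_cmPointClassFieldData_iff_beta.trans tyz_cmPointClassFieldDataBeta_iff_betaField

end Literature.NumberTheory.EllipticCurves.TianYuanZhang2017

end
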